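import Summits.QuantumFields.YangMills.Theorems.BalabanUVNodesPortS1Frame
import Literature.Analysis.Matrix.DetExp
import Mathlib.Analysis.SpecialFunctions.Complex.Log
import Literature.MathematicalPhysics.QuantumLattice.LiebRobinsonFnwGapConvergenceProofs

/-!
# NODE O port PT-A, [RG-I] §2 (2.3) ∕ p. 258 — THE CHART ROUND TRIP, analysis half: the series logarithm of an `SU(2)` matrix near the unit is
# traceless, hence `exp ∘ chartMat ∘ recordEmb` RETURNS the background field `U_{k+1}(W_B)` bondwise, and the signed chart∘embedding pair
# produces the configuration pair `(U_{k+1}(W_B) cut to X, 𝐉 = 0)` — the exact chart side of the (S1) row `Repr17` at the record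

Cell `ym-nodeO-ideate`, porter seat `ymgap-nodeO-port-PTA-1` (gen 0); `--supports stmt-QuantumFields-27930`; PORT-PLAN v1 rows S1-F ∕ S2-sel.
[I] = [Balaban1987RG1].  Print p. 258: «U_k = exp(iηH′) modulo a gauge transformation … 𝐄^{(j)}(X, U_k) = 𝐄^{(j)}(X, exp iηH′)»; (1.10) p. 262:
for `G = SU(2)` the algebra `𝔤ᶜ = 𝔰𝔩₂(ℂ)` is the traceless matrices — the three chart coordinates per bond of DEF-1's `recordChartDim`.

CONTENTS.  §1 `norm_trace_le_two_mul` (trace against the `L²`-operator norm, entries by the tree's `QuantumLattice.norm_apply_le_l2_opNorm`; folklore);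
★ `trace_mlog_eq_zero_of_SU2` — `tr (mlog U) = 0` for `U ∈ SU(2)`, `‖U − 1‖ ≤ ½` (`det ∘ exp = exp ∘ tr` from `Literature.Analysis.Matrix.DetExp`,
`exp ∘ mlog = id` from `MatrixLog`, `|tr| ≤ 2 log 2 < 2π`).  §2 ★ `exp_chartMat_recordEmb` — `exp (chartMat (recordEmb … B) b) = U_{k+1}(W_B)_b` whenever
`‖U_{k+1}(W_B)_b − 1‖ ≤ ½`; ★ `decodeCfg_recordChart_recordEmb` — under the same smallness on the bonds of `X`, the signed chart∘embedding pair decodes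
to the pair `(b ↦ if b ∈ X then U_{k+1}(W_B)_b else 1, 𝐉 = 0)`.  So the (S1) row at the record reads, near `B = 0` (where S2-sel supplies the smallness):
`𝓝_{k+1}(W_B) = Σ_X Ep n X (U_{k+1}(W_B)|_X ; 1 off X ; 𝐉 = 0)` — print's (1.9) evaluates at `𝐉 = J(U_{k+1})` instead (porter memo J-CHANNEL-27930-v1).

HONEST FRAMING.  Matrix bookkeeping; the smallness `‖U_{k+1}(W_B)_b − 1‖ ≤ ½` near `B = 0` ([15] Thm 1 + the rooted-gauge selector `UkSel`) is NOT
proved here (row S2-sel); nothing of Bałaban's estimates asserted, ported or discharged; 27930 OPEN; K0⁷ NOT closed; NODE O 0∕1; COUNT 8∕28 · K 1∕4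
UNMOVED; finite `𝕋⁴_{L^K}` at fixed ε — NOT continuum ∕ OS ∕ Clay; **the Yang–Mills mass gap is NOT proved by any of this.**  No `sorry`, no `def`,
no `instance`; standard axioms.
-/

noncomputable section

open scoped BigOperators Matrix.Norms.L2Operator Topology

namespace Summit.QuantumFields.YangMills.Theorems.BalabanUVNodesPortS1

open Summit.QuantumFields.YangMills.Theorems.K0RecordFormatNames
open Literature.MathematicalPhysics.QuantumFieldTheory.Balaban1983to89
open Literature.MathematicalPhysics.QuantumFieldTheory.Balaban1983to89.Node00
open Literature.MathematicalPhysics.QuantumFieldTheory.Balaban1983to89.T4Continuum (T4Family)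
open NormedSpace (exp)

/-! ## §1  Entries, trace, and the traceless logarithm on `SU(2)` near the unit -/

/-- `‖tr A‖ ≤ 2‖A‖` for a `2 × 2` complex matrix in the `L²`-operator norm. [folklore] -/
theorem norm_trace_le_two_mul (A : MatA 2) : ‖A.trace‖ ≤ 2 * ‖A‖ := by
  calc ‖A.trace‖ = ‖∑ i, A i i‖ := rfl
    _ ≤ ∑ i, ‖A i i‖ := norm_sum_le _ _
    _ ≤ ∑ _i : Fin 2, ‖A‖ := Finset.sum_le_sum fun i _ => Literature.MathematicalPhysics.QuantumLattice.norm_apply_le_l2_opNorm A i i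
    _ = 2 * ‖A‖ := by rw [Finset.sum_const, Finset.card_univ, Fintype.card_fin, nsmul_eq_mul]; norm_num

/-- **The series logarithm of an `SU(2)` matrix within `½` of the unit is TRACELESS** (`𝔤ᶜ = 𝔰𝔩₂(ℂ)`): from `det (exp A) = exp (tr A)`,
`exp (mlog U) = U`, `det U = 1` and `‖tr (mlog U)‖ ≤ 2 log 2 < 2π`. [cite: Balaban1987RG1, (1.10) p.262 (𝔤ᶜ for G = SU(2)); bookkeeping] -/
theorem trace_mlog_eq_zero_of_SU2 (U : SU 2) (hU : ‖(U : MatA 2) - 1‖ ≤ 1 / 2) : (MatrixLog.mlog (U : MatA 2)).trace = 0 := by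
  set A : MatA 2 := MatrixLog.mlog (U : MatA 2) with hAdef
  have hU1 : ‖(U : MatA 2) - 1‖ < 1 := by linarith
  have hexp : exp A = (U : MatA 2) := MatrixLog.exp_mlog hU1
  have hdet : (U : MatA 2).det = 1 := (Matrix.mem_specialUnitaryGroup_iff.mp U.2).2
  have htr : exp A.trace = (1 : ℂ) := by
    have h := Literature.Analysis.Matrix.det_exp_eq_exp_trace A
    rw [hexp, hdet] at h
    exact h.symm
  have htrC : Complex.exp A.trace = 1 := by
    rw [Complex.exp_eq_exp_ℂ]; exact htr
  obtain ⟨n, hn⟩ := Complex.exp_eq_one_iff.mp htrC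
  have hAn : ‖A‖ ≤ Real.log 2 := MatrixLog.norm_mlog_le_log_two hU
  have hlt : ‖A.trace‖ < 2 * Real.pi := by
    have hlog : Real.log 2 < 1 := by
      have := Real.log_two_lt_d9; linarith
    calc ‖A.trace‖ ≤ 2 * ‖A‖ := norm_trace_le_two_mul A
      _ ≤ 2 * Real.log 2 := by linarith
      _ < 2 * Real.pi := by nlinarith [Real.pi_gt_three]
  have hn0 : n = 0 := by
    by_contra h
    have h1 : (1 : ℝ) ≤ |(n : ℝ)| := by exact_mod_cast Int.one_le_abs h
    rw [hn] at hlt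
    have hnorm : ‖(n : ℂ) * (2 * Real.pi * Complex.I)‖ = |(n : ℝ)| * (2 * Real.pi) := by
      rw [norm_mul, Complex.norm_intCast, norm_mul, Complex.norm_I, mul_one, norm_mul, Complex.norm_ofNat,
        Complex.norm_real, Real.norm_of_nonneg Real.pi_pos.le]
    rw [hnorm] at hlt
    nlinarith [Real.pi_pos]
  rw [hn, hn0]
  simp

/-! ## §2  The round trip `exp ∘ chartMat ∘ recordEmb = U_{k+1}(W_·)` and what the signed chart∘embedding pair decodes to -/

variable (F : T4Family)

/-- **THE CHART ROUND TRIP** at a bond where the rooted-gauge background field is within `½` of the unit: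
`exp (chartMat (recordEmb F θ k K B) b) = U_{k+1}(W_B)_b`. [cite: Balaban1987RG1, p.258 («U_k = exp(iηH′)»), (4.35) p.290] -/
theorem exp_chartMat_recordEmb (θ : Stage13Params F 2) (k K : ℕ) (B : Fin (F.P K).d → Site (F.P K) (k + 1) → θ.Vβ) (b : PBond (F.P K) 0)
    (hU : ‖((recordBgField F θ k K B b : SU 2) : MatA 2) - 1‖ ≤ 1 / 2) :
    exp (chartMat F K (recordEmb F θ k K B) b) = ((recordBgField F θ k K B b : SU 2) : MatA 2) := by
  rw [chartMat_recordEmb, trace_mlog_eq_zero_of_SU2 _ hU, zero_div, zero_smul, sub_zero]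
  exact MatrixLog.exp_mlog (by linarith)

open scoped Classical in
/-- **WHAT THE SIGNED CHART∘EMBEDDING PAIR FEEDS THE PIECES** (the chart side of `Repr17` at the record, exactly): when the rooted-gauge background
field `U_{k+1}(W_B)` is within `½` of the unit on the bonds of `X`, `decodeCfg (recordChart X (recordEmb B))` is the pair «`U_{k+1}(W_B)` on the bonds
of `X`, `1` off `X`; `𝐉 = 0`».  Print's (1.9) p. 261 evaluates the pieces at `(U_{k+1}, J(U_{k+1}))` with the current (1.8) in the second slot — the
porter's located divergence (memo J-CHANNEL-27930-v1); recorded, not judged, here. [cite: Balaban1987RG1, (1.8)–(1.9) p.261, p.258, (4.4) p.281] -/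
theorem decodeCfg_recordChart_recordEmb (θ : Stage13Params F 2) (Mc k K : ℕ) (X : (recordDomSys F Mc k K).Dom)
    (B : Fin (F.P K).d → Site (F.P K) (k + 1) → θ.Vβ)
    (hU : ∀ b ∈ domBonds F Mc k K X, ‖((recordBgField F θ k K B b : SU 2) : MatA 2) - 1‖ ≤ 1 / 2) :
    decodeCfg F K (recordChart F Mc k K X (recordEmb F θ k K B)) =
      (fun b => if b ∈ domBonds F Mc k K X then ((recordBgField F θ k K B b : SU 2) : MatA 2) else 1, fun _ => 0) := by
  classical
  refine Prod.ext ?_ (decodeCfg_recordChart_snd F Mc k K X _)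
  funext b
  show (decodeCfg F K (recordChart F Mc k K X (recordEmb F θ k K B))).1 b =
    if b ∈ domBonds F Mc k K X then ((recordBgField F θ k K B b : SU 2) : MatA 2) else 1
  by_cases hb : b ∈ domBonds F Mc k K X
  · rw [decodeCfg_recordChart_fst_of_mem F Mc k K X _ hb, if_pos hb, exp_chartMat_recordEmb F θ k K B b (hU b hb)]
  · rw [decodeCfg_recordChart_fst_of_not_mem F Mc k K X _ hb, if_neg hb]

/-! ## §3  (v2 APPEND, DEF-1 edition 7 ✓p793840, the (R-J) two-block names) THE ROUND TRIP FOR THE TWO-BLOCK CHART∕EMBEDDING: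
`sl2Proj` is traceless, the current (1.8) through `sl2Proj` is traceless, `chartMatU ∘ recordEmbJ = mlog ∘ U` and `chartMatJc ∘ recordEmbJ = J(U)` bondwise,
hence `recordChartJ X (recordEmbJ B)` decodes to print's (1.9) pair `(U_{k+1}(W_B), J(U_{k+1}(W_B)))` CUT TO `X` -/

/-- The `𝐔`-block chart matrix of a two-block coordinate vector READ OFF two bond-indexed coordinate families is the resummation of the first family.
[cite: Balaban1987RG1, (1.9) p.261 (bookkeeping)] -/
theorem chartMatU_sumElim (K : ℕ) (f g : PBond (F.P K) 0 → Fin 3 → ℂ) (b : PBond (F.P K) 0) :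
    chartMatU F K (fun i => Sum.elim (f ((chartEquivJ F K).symm i).1) (g ((chartEquivJ F K).symm i).1) ((chartEquivJ F K).symm i).2) b =
      ∑ a : Fin 3, f b a • sl2Gen a := by
  simp only [chartMatU, Equiv.symm_apply_apply, Sum.elim_inl]

/-- The `𝐉`-block chart matrix of a two-block coordinate vector READ OFF two bond-indexed coordinate families is the resummation of the second family.
[cite: Balaban1987RG1, (1.9) p.261 (bookkeeping)] -/
theorem chartMatJc_sumElim (K : ℕ) (f g : PBond (F.P K) 0 → Fin 3 → ℂ) (b : PBond (F.P K) 0) :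
    chartMatJc F K (fun i => Sum.elim (f ((chartEquivJ F K).symm i).1) (g ((chartEquivJ F K).symm i).1) ((chartEquivJ F K).symm i).2) b =
      ∑ a : Fin 3, g b a • sl2Gen a := by
  simp only [chartMatJc, Equiv.symm_apply_apply, Sum.elim_inr]

/-- **`chartMatU ∘ recordEmbJ`** is the series logarithm of the background field up to its trace part. [cite: Balaban1987RG1, p.258, (1.9) p.261] -/
theorem chartMatU_recordEmbJ (θ : Stage13Params F 2) (k K : ℕ) (B : Fin (F.P K).d → Site (F.P K) (k + 1) → θ.Vβ) (b : PBond (F.P K) 0) :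
    chartMatU F K (recordEmbJ F θ k K B) b =
      MatrixLog.mlog ((recordBgField F θ k K B b : SU 2) : MatA 2) - ((MatrixLog.mlog ((recordBgField F θ k K B b : SU 2) : MatA 2)).trace / 2) • (1 : MatA 2) := by
  have h : chartMatU F K (recordEmbJ F θ k K B) b =
      ∑ a : Fin 3, sl2Coord (MatrixLog.mlog ((recordBgField F θ k K B b : SU 2) : MatA 2)) a • sl2Gen a := by
    simp only [chartMatU, recordEmbJ, Equiv.symm_apply_apply, Sum.elim_inl]
  rw [h]
  exact sum_sl2Coord_smul_sl2Gen _

/-- **`chartMatJc ∘ recordEmbJ`** is the current of the background field up to its trace part. [cite: Balaban1987RG1, (1.8)–(1.9) p.261] -/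
theorem chartMatJc_recordEmbJ (θ : Stage13Params F 2) (k K : ℕ) (B : Fin (F.P K).d → Site (F.P K) (k + 1) → θ.Vβ) (b : PBond (F.P K) 0) :
    chartMatJc F K (recordEmbJ F θ k K B) b =
      recordCurrent F θ k K B b - ((recordCurrent F θ k K B b).trace / 2) • (1 : MatA 2) := by
  have h : chartMatJc F K (recordEmbJ F θ k K B) b = ∑ a : Fin 3, sl2Coord (recordCurrent F θ k K B b) a • sl2Gen a := by
    simp only [chartMatJc, recordEmbJ, Equiv.symm_apply_apply, Sum.elim_inr]
  rw [h]
  exact sum_sl2Coord_smul_sl2Gen _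

/-- **`sl2Proj` is print's projection onto `𝔤ᶜ = 𝔰𝔩₂(ℂ)`: its values are TRACELESS.** [cite: Balaban1987RG1, (1.8) p.261, (1.10) p.262] -/
theorem trace_sl2Proj (A : MatA 2) : (sl2Proj A).trace = 0 := by
  simp [sl2Proj, Matrix.trace_one, Matrix.trace_smul]
  ring

/-- `sl2Proj A = A − (tr A ∕ 2)·1`. [cite: Balaban1987RG1, (1.8) p.261 (bookkeeping)] -/
theorem sl2Proj_apply (A : MatA 2) : sl2Proj A = A - (A.trace / 2) • (1 : MatA 2) := by
  simp [sl2Proj, div_eq_inv_mul, smul_smul]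

/-- The plaquette function `ξ⁻² π Im ∂𝐔` of (1.8) is traceless for `π = sl2Proj`. [cite: Balaban1987RG1, (1.8) p.261] -/
theorem trace_imPlaq_sl2Proj {P : Params} {i : ℕ} (ξ : ℝ) (U : PBond P i → (MatA 2)ˣ) (μ ν : Fin P.d) (x : Site P i) :
    (B12Eq18Current.imPlaq sl2Proj ξ U μ ν x).trace = 0 := by
  simp only [B12Eq18Current.imPlaq, Matrix.trace_smul, trace_sl2Proj, smul_zero]

/-- A conjugate `R_U X = U X U⁻¹` has the trace of `X`. [folklore] -/
theorem trace_R (U : (MatA 2)ˣ) (X : MatA 2) : (B9Eq39Adjoint.R U X).trace = X.trace := by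
  rw [B9Eq39Adjoint.R, Matrix.trace_mul_cycle, Units.inv_mul, one_mul]

/-- The covariant backward difference `D*_μ` of a traceless site function is traceless. [folklore] -/
theorem trace_covDstar_eq_zero {P : Params} {i : ℕ} (U : PBond P i → (MatA 2)ˣ) (μ : Fin P.d) (G : Site P i → MatA 2)
    (hG : ∀ y, (G y).trace = 0) (x : Site P i) :
    (B9Eq39Adjoint.covDstar (B9TorusCalculus.torusT P i) (B12Eq18Current.dirForm U) μ G x).trace = 0 := by
  rw [B9Eq39Adjoint.covDstar, Matrix.trace_sub, trace_R, hG, hG, sub_zero]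

/-- **The current (1.8) through `sl2Proj` is TRACELESS** (`D^{ξ*}` is a sum of covariant differences of conjugates of traceless plaquette values).
[cite: Balaban1987RG1, (1.8) p.261] -/
theorem trace_current_sl2Proj {P : Params} {i : ℕ} (ξ : ℝ) (U : PBond P i → (MatA 2)ˣ) (b : PBond P i) :
    (B12Eq18Current.current sl2Proj ξ U b).trace = 0 := by
  rw [B12Eq18Current.current_apply, Matrix.trace_smul, B9Eq39Adjoint.divP, Matrix.trace_sub, Matrix.trace_sum, Matrix.trace_sum]
  have h1 : ∀ ν, (if ν < b.dir then B9Eq39Adjoint.covDstar (B9TorusCalculus.torusT P i) (B12Eq18Current.dirForm U) ν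
      (B12Eq18Current.imPlaq sl2Proj ξ U ν b.dir) b.src else 0).trace = 0 := by
    intro ν
    split_ifs
    · exact trace_covDstar_eq_zero U ν _ (fun y => trace_imPlaq_sl2Proj ξ U ν b.dir y) b.src
    · exact Matrix.trace_zero _ _
  have h2 : ∀ ν, (if b.dir < ν then B9Eq39Adjoint.covDstar (B9TorusCalculus.torusT P i) (B12Eq18Current.dirForm U) ν
      (B12Eq18Current.imPlaq sl2Proj ξ U b.dir ν) b.src else 0).trace = 0 := by
    intro ν
    split_ifs
    · exact trace_covDstar_eq_zero U ν _ (fun y => trace_imPlaq_sl2Proj ξ U b.dir ν y) b.src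
    · exact Matrix.trace_zero _ _
  simp only [h1, h2, Finset.sum_const_zero, sub_zero, smul_zero]

/-- **The record current `J_{k+1}(W_B)` is traceless** (𝔰𝔩₂(ℂ)-valued). [cite: Balaban1987RG1, (1.8) p.261] -/
theorem trace_recordCurrent (θ : Stage13Params F 2) (k K : ℕ) (B : Fin (F.P K).d → Site (F.P K) (k + 1) → θ.Vβ) (b : PBond (F.P K) 0) :
    (recordCurrent F θ k K B b).trace = 0 :=
  trace_current_sl2Proj _ _ b

/-- **`chartMatJc ∘ recordEmbJ = J(U_{k+1}(W_·))` exactly.** [cite: Balaban1987RG1, (1.8)–(1.9) p.261] -/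
theorem chartMatJc_recordEmbJ_eq_current (θ : Stage13Params F 2) (k K : ℕ) (B : Fin (F.P K).d → Site (F.P K) (k + 1) → θ.Vβ) (b : PBond (F.P K) 0) :
    chartMatJc F K (recordEmbJ F θ k K B) b = recordCurrent F θ k K B b := by
  rw [chartMatJc_recordEmbJ, trace_recordCurrent, zero_div, zero_smul, sub_zero]

/-- **`exp ∘ chartMatU ∘ recordEmbJ = U_{k+1}(W_·)`** at a bond where the rooted-gauge background field is within `½` of the unit.
[cite: Balaban1987RG1, p.258, (1.9) p.261] -/
theorem exp_chartMatU_recordEmbJ (θ : Stage13Params F 2) (k K : ℕ) (B : Fin (F.P K).d → Site (F.P K) (k + 1) → θ.Vβ) (b : PBond (F.P K) 0)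
    (hU : ‖((recordBgField F θ k K B b : SU 2) : MatA 2) - 1‖ ≤ 1 / 2) :
    exp (chartMatU F K (recordEmbJ F θ k K B) b) = ((recordBgField F θ k K B b : SU 2) : MatA 2) := by
  rw [chartMatU_recordEmbJ, trace_mlog_eq_zero_of_SU2 _ hU, zero_div, zero_smul, sub_zero]
  exact MatrixLog.exp_mlog (by linarith)

open scoped Classical in
/-- **WHAT THE TWO-BLOCK CHART∘EMBEDDING PAIR FEEDS THE PIECES = PRINT's (1.9) PAIR CUT TO `X`**: when the rooted-gauge background field `U_{k+1}(W_B)` is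
within `½` of the unit on the bonds of `X`, `decodeCfg (recordChartJ X (recordEmbJ B))` is the pair «`U_{k+1}(W_B)` on the bonds of `X`, `1` off `X`;
`J(U_{k+1}(W_B))` on the bonds of `X`, `0` off `X`» — (1.9)'s argument `(U_j, J_j)` restricted to `X` ((1.7) «depends on U_j restricted to X»).
[cite: Balaban1987RG1, (1.7), (1.8)–(1.9) p.261] -/
theorem decodeCfg_recordChartJ_recordEmbJ (θ : Stage13Params F 2) (Mc k K : ℕ) (X : (recordDomSys F Mc k K).Dom)
    (B : Fin (F.P K).d → Site (F.P K) (k + 1) → θ.Vβ)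
    (hU : ∀ b ∈ domBonds F Mc k K X, ‖((recordBgField F θ k K B b : SU 2) : MatA 2) - 1‖ ≤ 1 / 2) :
    decodeCfg F K (recordChartJ F Mc k K X (recordEmbJ F θ k K B)) =
      (fun b => if b ∈ domBonds F Mc k K X then ((recordBgField F θ k K B b : SU 2) : MatA 2) else 1,
       fun b => if b ∈ domBonds F Mc k K X then recordCurrent F θ k K B b else 0) := by
  classical
  have hdec : decodeCfg F K (recordChartJ F Mc k K X (recordEmbJ F θ k K B)) =
      (fun b => if b ∈ domBonds F Mc k K X then exp (chartMatU F K (recordEmbJ F θ k K B) b) else 1,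
       fun b => if b ∈ domBonds F Mc k K X then chartMatJc F K (recordEmbJ F θ k K B) b else 0) := by
    simp [recordChartJ]
  rw [hdec, Prod.mk.injEq]
  refine ⟨funext fun b => ?_, funext fun b => ?_⟩
  · by_cases hb : b ∈ domBonds F Mc k K X
    · rw [if_pos hb, if_pos hb, exp_chartMatU_recordEmbJ F θ k K B b (hU b hb)]
    · rw [if_neg hb, if_neg hb]
  · by_cases hb : b ∈ domBonds F Mc k K X
    · rw [if_pos hb, if_pos hb, chartMatJc_recordEmbJ_eq_current]
    · rw [if_neg hb, if_neg hb]

/-! ## §4  (v3 APPEND) ROW (f) OF THE (S1) MOULD REDUCED TO PRINT's SENTENCE: the representation hypothesis of `formatPlusG_record_of_cpairRows(Ctr)` at the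
two-block chart∕embedding follows from the (1.6)–(1.7)∕(1.9) identity «functional = Σ_X piece_X((U_{k+1}, J(U_{k+1})) cut to X)» eventually near `B = 0`, plus the
eventual smallness `‖U_{k+1}(W_B)_b − 1‖ ≤ ½` (row S2-sel) -/

open scoped Classical in
/-- **Row (f) at the two-block names ⟸ print's (1.7)∕(1.9) identity, along any filter.**  If eventually (along `l`) the rooted-gauge background field of `Bf t` is
within `½` of the unit on every fine bond, and eventually the functional `Φ t` IS the sum over the catalogue of the pieces ON PAIRS evaluated at print's (1.9) pair
`(U_{k+1}(W_{Bf t}), J(U_{k+1}(W_{Bf t})))` CUT TO `X`, then eventually `Φ t = Σ_X Ep X (decodeCfg (recordChartJ X (recordEmbJ (Bf t))))` — hypothesis (f) of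
`formatPlusG_record_of_cpairRowsCtr` with `χ := recordChartJ`, `ι := recordEmbJ` (take `l := 𝓝 0`, `Bf := id`). [cite: Balaban1987RG1, (1.6)–(1.7) and (1.9) p.261] -/
theorem eventually_repr_recordChartJ_of_pairIdentity (θ : Stage13Params F 2) (Mc k K : ℕ) {τ : Type*} {l : Filter τ}
    (Bf : τ → (Fin (F.P K).d → Site (F.P K) (k + 1) → θ.Vβ)) (Φ : τ → ℂ)
    (Ep : (recordDomSys F Mc k K).Dom → Sect2.CPair (F.P K) (MatA 2) → ℂ)
    (hU : ∀ᶠ t in l, ∀ b : PBond (F.P K) 0, ‖((recordBgField F θ k K (Bf t) b : SU 2) : MatA 2) - 1‖ ≤ 1 / 2)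
    (hΦ : ∀ᶠ t in l, Φ t = ∑ X : (recordDomSys F Mc k K).Dom,
      Ep X (fun b => if b ∈ domBonds F Mc k K X then ((recordBgField F θ k K (Bf t) b : SU 2) : MatA 2) else 1,
            fun b => if b ∈ domBonds F Mc k K X then recordCurrent F θ k K (Bf t) b else 0)) :
    ∀ᶠ t in l, Φ t = ∑ X : (recordDomSys F Mc k K).Dom, Ep X (decodeCfg F K (recordChartJ F Mc k K X (recordEmbJ F θ k K (Bf t)))) := by
  filter_upwards [hU, hΦ] with t htU htΦ
  rw [htΦ]
  refine Finset.sum_congr rfl fun X _ => ?_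
  rw [decodeCfg_recordChartJ_recordEmbJ F θ Mc k K X (Bf t) fun b _ => htU b]

end Summit.QuantumFields.YangMills.Theorems.BalabanUVNodesPortS1

end
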